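import Summits.HodgeConjecture.HodgeConjecture.Theorems.HeckePrymWeilWeilTwelvefoldsSqrtMinus7AimedGlue
import Summits.HodgeConjecture.HodgeConjecture.Theorems.HeckePrymWeilWeilTwelvefoldsSqrtMinus7AimedSplitProductSevenHolds
import HarnessLib

/-!
# `WeilTwelvefoldsSqrtMinus7` from hyperbolic `ℚ(√-7)`-Weil fourteenfolds and Hodge–Riemann in degree one

Crux `WeilTwelvefoldsSqrtMinus7` (stmt-HodgeConjecture-1261) of route `HeckePrymWeil`, line
`amnesic-secant-sheaves-split-fourteenfolds` (lead seat c1) — THE LINE'S DELIVERABLE, registered sub-goal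
`weilTwelvefolds_of_hyperbolicFourteenfolds_of_hodgeRiemann`: the crux (every rational `(6,6)` Weil class on
every `ℚ(√-7)`-Weil abelian 12-fold is algebraic) follows from ONE input —
(S1) the Hodge–Weil classes are algebraic on every complex abelian 14-fold `(X, ψ)`, `ψ ≫ ψ = -7`, of HYPERBOLIC
Weil type for the `K`-symmetrised hyperplane class of some projective embedding (open mathematics: Markman's
question in dimension `≥ 8`, arXiv:2502.03415 §1.2 / arXiv:2509.23403 §12; the stub `stub_hyperbolicFourteenfolds`
of the skeleton) — `weilTwelvefolds_of_hyperbolicFourteenfolds`; the registered two-input form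
`weilTwelvefolds_of_hyperbolicFourteenfolds_of_hodgeRiemann` keeps Hodge–Riemann in degree one for the hyperplane
class (Voisin I Thm. 6.32 at `k = 1`, the line's leaf `stub_hodgeRiemannDegreeOne`) explicit; that leaf is CLOSED by
the tree's theorem `Literature.AlgebraicGeometry.HodgeTheory.hodgeRiemann_degreeOne` (file `…HodgeRiemannLeaf`). Everything else of Markman's §11.5 Step 2 / Schoen's
§10 product trick at `d = 7` — the CM partner `E × E`, `E = ℂ/(ℤ + ℤ√-7)` with `[√-7]`, its
degree-one model, its descent pair, the Weil multiplicities, the signature of the rational model, the weighted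
Segre embedding, the aiming arithmetic and the descent — is PROVED in the tree (files
`Theorems/HeckePrymWeilWeilTwelvefoldsSqrtMinus7*`). Proof: `aimedSplitProduct_seven_of_hodgeRiemann` at
`n = 6` is the aimed partner hypothesis of `weilTwelvefolds_of_splitFourteenfolds_of_aimedPartner` (lead -1's glue).
-/

noncomputable section

set_option linter.dupNamespace false

open CategoryTheory Complex
open Literature.AlgebraicGeometry Literature.AlgebraicGeometry.Motives
  Literature.AlgebraicGeometry.HodgeTheory Literature.AlgebraicTopology.SingularHomology

namespace Summit.HodgeConjecture.HodgeConjecture.Theorems.WeilTwelvefoldsSqrtMinus7.AmnesicSecantSheaves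

/-- **Hyperbolic fourteenfolds (S1) + Hodge–Riemann in degree one ⟹ `WeilTwelvefoldsSqrtMinus7`.**
[cite: Markman2025SurveySecant, §11.5 Step 2] [cite: Schoen1998HodgeWeilAddendum, §10]
[cite: VoisinHodgeI2002, Thm. 6.32] -/
theorem weilTwelvefolds_of_hyperbolicFourteenfolds_of_hodgeRiemann :
    (∀ (X : AbelianVariety ℂ) (ψ : X ⟶ X), X.dim = 14 → ψ ≫ ψ = -((7 : ℤ) • 𝟙 X) →
    ∀ (e : ProjectiveEmbedding X.X) (a : complexBetti (projectiveSpace e.n ℂ) 2),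
      IsRationalClass a → a ≠ 0 →
      IsHyperbolicWeilType X ψ 7
        ((7 : ℂ) • complexBetti.map e.ι 2 a + complexBetti.map ψ.hom.hom.hom 2 (complexBetti.map e.ι 2 a)) →
    ∀ c : complexBetti X.X 14, IsRationalClass c → IsOfHodgeType 14 X.X 14 7 7 c →
      c ∈ Module.End.eigenspace (complexBetti.map (𝟙 X + ψ).hom.hom.hom 14).hom
            ((1 + Complex.I * (Real.sqrt (7 : ℝ) : ℂ)) ^ 14) ⊔
          Module.End.eigenspace (complexBetti.map (𝟙 X + ψ).hom.hom.hom 14).hom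
            ((1 - Complex.I * (Real.sqrt (7 : ℝ) : ℂ)) ^ 14) →
      c ∈ algebraicClasses X.X 7) →
    (∀ ⦃d : ℕ⦄ ⦃X : SchemeOver ℂ⦄, IsSmoothProjective (d + 1) X →
      ∀ (e : ProjectiveEmbedding X) (a : complexBetti (projectiveSpace e.n ℂ) 2),
        IsRationalClass a → a ≠ 0 →
      ∀ (M : HodgeModel (d + 1) X), M.IsReal →
        ∃ ω₀ : complexBetti X (2 + 2 * d), IsRationalClass ω₀ ∧ ω₀ ≠ 0 ∧
          ∀ x : complexBetti X 1, M.pullback 1 x ∈ M.hodgePQ 1 1 0 → x ≠ 0 →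
            ∃ t : ℝ, 0 < t ∧
              Complex.I • polarizationPairingOne X (complexBetti.map e.ι 2 a) d x
                (conjClass (ComplexPoints X) 1 x) = (t : ℂ) • ω₀) →
    Summit.HodgeConjecture.HodgeConjecture.Theses.HeckePrymWeil.WeilTwelvefoldsSqrtMinus7 := by
  intro h14 hHR
  obtain ⟨B, ψ, hB, hψ, hpair, hall⟩ := aimedSplitProduct_seven_of_hodgeRiemann hHR
  refine weilTwelvefolds_of_splitFourteenfolds_of_aimedPartner h14 fun A φ hA hφ hc => ?_
  obtain ⟨e, a, ha, ha0, hhyp⟩ := hall 6 A φ (by norm_num) hA hφ hc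
  exact ⟨B, ψ, hB, hψ, hpair, e, a, ha, ha0, hhyp⟩


/-- **Hyperbolic fourteenfolds (S1) ⟹ `WeilTwelvefoldsSqrtMinus7`** — the crux reduced to ONE hypothesis, open
mathematics (Markman's question in dimension `≥ 8` for `K = ℚ(√-7)`, one rung up): the Hodge–Weil classes are
algebraic on every `ℚ(√-7)`-Weil abelian 14-fold of HYPERBOLIC type for the `K`-symmetrised hyperplane class of some
projective embedding. Hodge–Riemann in degree one, the second input of `…_of_hodgeRiemann`, is a theorem of the tree.
[cite: Markman2025SurveySecant, §11.5 Step 2 and §12] [cite: Schoen1998HodgeWeilAddendum, §10] -/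
theorem weilTwelvefolds_of_hyperbolicFourteenfolds :
    (∀ (X : AbelianVariety ℂ) (ψ : X ⟶ X), X.dim = 14 → ψ ≫ ψ = -((7 : ℤ) • 𝟙 X) →
    ∀ (e : ProjectiveEmbedding X.X) (a : complexBetti (projectiveSpace e.n ℂ) 2),
      IsRationalClass a → a ≠ 0 →
      IsHyperbolicWeilType X ψ 7
        ((7 : ℂ) • complexBetti.map e.ι 2 a + complexBetti.map ψ.hom.hom.hom 2 (complexBetti.map e.ι 2 a)) →
    ∀ c : complexBetti X.X 14, IsRationalClass c → IsOfHodgeType 14 X.X 14 7 7 c →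
      c ∈ Module.End.eigenspace (complexBetti.map (𝟙 X + ψ).hom.hom.hom 14).hom
            ((1 + Complex.I * (Real.sqrt (7 : ℝ) : ℂ)) ^ 14) ⊔
          Module.End.eigenspace (complexBetti.map (𝟙 X + ψ).hom.hom.hom 14).hom
            ((1 - Complex.I * (Real.sqrt (7 : ℝ) : ℂ)) ^ 14) →
      c ∈ algebraicClasses X.X 7) →
    Summit.HodgeConjecture.HodgeConjecture.Theses.HeckePrymWeil.WeilTwelvefoldsSqrtMinus7 :=
  fun h14 => weilTwelvefolds_of_hyperbolicFourteenfolds_of_hodgeRiemann h14 stub_hodgeRiemannDegreeOne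

end Summit.HodgeConjecture.HodgeConjecture.Theorems.WeilTwelvefoldsSqrtMinus7.AmnesicSecantSheaves

end
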